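import Literature.NumberTheory.Sieve.SieveFrameworkFundamentalLemma

/-!
# The beta-sieve upper bound for a general sifting set `P ∣ P(z)`

Topic `Literature/NumberTheory/Sieve`, companion file of `SieveFramework.lean` /
`SieveFrameworkFundamentalLemma.lean`. The tree's Fundamental Lemma
(`SieveSequence.fundamental_lemma_uniform_holds`) sifts by `P(z) = ∏_{p<z} p`, i.e. by ALL primes
below `z`. Several classical applications (Bombieri's asymptotic sieve, [FriedlanderIwaniecPisa1978]
Lemma 10 = Bombieri's Lemmata 1–2: sifting the subsequence `𝒜_d` by the primes `< z` that do NOT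
divide `d`; Chen's switching) need the sieve for a sifting set `P` consisting of SOME of the primes
below `z`, i.e. a squarefree `P ∣ P(z)`. This file proves the UPPER-bound half of the beta-sieve
theorem in that generality (the half used for such "Brun–Titchmarsh" purposes):

* `BetaSieve.bdry_sum_le_of_dvd` — Greaves' boundary-sum estimate (Lemma 3.3.6 with `b = 9`,
  the tree's `BetaSieve.bdry_sum_le`) for `P ∣ P(z)`:
  `∑_{t ∣ P} χ̄(t) g(t) V(P; q(t)) ≤ 2 K^{10} e^{β − s} V(P)`, `s = log D / log z`, `β = 9κ + 1`.
  It is REDUCED to the case `P = P(z)` by the monotonicity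
  `V(P; q) · V(P(z)) ≤ V(P) · V(P(z); q)` (the primes of `P(z)` above `q` missing from `P` only
  contribute factors `1 − g(p) ∈ (0, 1]`) and positivity of the summands;
* `SieveSequence.abs_upperWeightedSum_sub_le_of_dvd` — the weighted main-term estimate
  `|∑_{d ∣ P} μ(d)χ⁺(d) A_d(x) − X V(P)| ≤ 2K^{10} e^{β−s} X V(P) + ∑_{d ∣ P, d ≤ D} |R_d(x)|`
  (Greaves Thm 3.3.1 for the upper truncation set; the tree's `abs_weightedSum_sub_le` verbatim
  with `P(z)` replaced by `P ∣ P(z)`);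
* `SieveSequence.sifted_le_of_dvd_primesProdBelow` — **the upper-bound sieve**: for a sifted
  sequence of dimension `κ > 0` (constant `K`), `z ≥ 2`, `D ≥ z^{9κ+1}`, `X(x) ≥ 0` and a sifting
  set `P ∣ P(z)`,
  `S(𝒜, P; x) ≤ (1 + 2K^{10} e^{9κ+1−s}) X V(P) + ∑_{d ∣ P, d ≤ D} |R_d(x)|`
  (Greaves, *Sieves in Number Theory*, Thm 3.3.1 / Cor 3.3.1.1 [Greaves2001]; Friedlander–Iwaniec,
  *Opera de Cribro*, Lemma 6.8 / Thm 6.9 [FriedlanderIwaniecOpera2010], where the sifting set is an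
  arbitrary finite set of primes `𝒫` and `P(z) = ∏_{p ∈ 𝒫, p < z} p`).

Everything is proved from the tree (`BetaSieve.*` of `SieveFrameworkFundamentalLemma.lean`); no new
definitions and no named facts.

## References

* G. Greaves, *Sieves in Number Theory*, Springer (2001), §3.3.4 Lemma 6, Theorem 1,
  Corollary 1.1. [Greaves2001]
* J. Friedlander, H. Iwaniec, *Opera de Cribro*, AMS Coll. Publ. 57 (2010), §6.5 (sifting set
  `𝒫` arbitrary), Lemma 6.8, Thm 6.9. [FriedlanderIwaniecOpera2010]
-/

open Finset
open scoped ArithmeticFunction.Moebius ArithmeticFunction.omega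

noncomputable section

namespace Literature.NumberTheory.Sieve

namespace BetaSieve

variable {g : ArithmeticFunction ℝ} {κ K : ℝ} {par : ℕ} {β D : ℝ}

/-- Monotonicity of the partial products in the sifting set: for `P ∣ P'` (both squarefree is not
needed, only `P.primeFactors ⊆ P'.primeFactors`) and `0 ≤ g ≤ 1` on the primes of `P'`,
`V(P; q) · V(P') ≤ V(P) · V(P'; q)`: indeed `V(P) = V(P; q) ∏_{p ∣ P, p ≥ q} (1 − g p)` and the
product over the primes of `P'` above `q` has more factors, all in `[0, 1]`. [folklore] -/
theorem vlt_mul_vprod_le {P P' : ℕ} (hsub : P.primeFactors ⊆ P'.primeFactors)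
    (h01 : ∀ p ∈ P'.primeFactors, 0 ≤ g p ∧ g p ≤ 1) (q : ℕ) :
    vlt g P q * vprod g P' ≤ vprod g P * vlt g P' q := by
  have h01P : ∀ p ∈ P.primeFactors, 0 ≤ g p ∧ g p ≤ 1 := fun p hp => h01 p (hsub hp)
  rw [vprod_eq_vlt_mul (g := g) (P := P') q, vprod_eq_vlt_mul (g := g) (P := P) q]
  -- `∏_{p ∣ P', p ≥ q} (1 - g p) ≤ ∏_{p ∣ P, p ≥ q} (1 - g p)`
  have hle : ∏ p ∈ P'.primeFactors.filter (fun p => ¬ p < q), (1 - g p) ≤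
      ∏ p ∈ P.primeFactors.filter (fun p => ¬ p < q), (1 - g p) := by
    have hsub' : P.primeFactors.filter (fun p => ¬ p < q) ⊆
        P'.primeFactors.filter (fun p => ¬ p < q) := Finset.filter_subset_filter _ hsub
    rw [← Finset.prod_sdiff hsub']
    refine mul_le_of_le_one_left (Finset.prod_nonneg fun p hp => ?_)
      (Finset.prod_le_one (fun p hp => ?_) (fun p hp => ?_))
    · exact sub_nonneg.mpr (h01P p (Finset.mem_filter.mp hp).1).2
    · exact sub_nonneg.mpr (h01 p (Finset.mem_filter.mp (Finset.mem_sdiff.mp hp).1).1).2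
    · linarith [(h01 p (Finset.mem_filter.mp (Finset.mem_sdiff.mp hp).1).1).1]
  have hv : 0 ≤ vlt g P q := vlt_nonneg h01P q
  have hv' : 0 ≤ vlt g P' q := vlt_nonneg h01 q
  calc vlt g P q * (vlt g P' q * ∏ p ∈ P'.primeFactors.filter (fun p => ¬ p < q), (1 - g p))
      = (vlt g P q * vlt g P' q) * ∏ p ∈ P'.primeFactors.filter (fun p => ¬ p < q), (1 - g p) := by
        ring
    _ ≤ (vlt g P q * vlt g P' q) * ∏ p ∈ P.primeFactors.filter (fun p => ¬ p < q), (1 - g p) :=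
        mul_le_mul_of_nonneg_left hle (mul_nonneg hv hv')
    _ = vlt g P q * (∏ p ∈ P.primeFactors.filter (fun p => ¬ p < q), (1 - g p)) * vlt g P' q := by
        ring

/-- **Greaves, Lemma 3.3.6 (`b = 9`) for a sifting set `P ∣ P(z)`**: for
`s = log D / log z ≥ β = 9κ + 1`,
`∑_{t ∣ P} χ̄(t) g(t) V(P; q(t)) ≤ 2 K^{10} e^{β − s} V(P)`.
Reduced to the tree's `bdry_sum_le` (`P = P(z)`) by `vlt_mul_vprod_le` and positivity: multiplying
by `V(P(z)) > 0`, each summand satisfies `χ̄ g V(P; q) V(P(z)) ≤ V(P) χ̄ g V(P(z); q)`, and the sum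
over `t ∣ P` of the nonnegative right-hand sides is at most the sum over `t ∣ P(z)`.
[cite: Greaves2001, §3.3.4 Lemma 6] [cite: FriedlanderIwaniecOpera2010, Lemma 6.8] -/
theorem bdry_sum_le_of_dvd (hg : g.IsMultiplicative) (hdim : HasSieveDimension g κ K) (hκ : 0 < κ)
    {z : ℝ} (hz : 2 ≤ z) (hD1 : 1 < D) (hβ : β = 9 * κ + 1)
    (hzD : β * Real.log z ≤ Real.log D) {P : ℕ} (hP : P ∣ primesProdBelow z) :
    ∑ t ∈ P.divisors, bdry par β D t * g t * vlt g P t.minFac ≤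
      2 * K ^ (10 : ℕ) * Real.exp (β - Real.log D / Real.log z) * vprod g P := by
  set Pz := primesProdBelow z with hPz
  have hPz0 : Pz ≠ 0 := primesProdBelow_ne_zero z
  have hPzsq : Squarefree Pz := squarefree_primesProdBelow z
  have hsub : P.primeFactors ⊆ Pz.primeFactors := Nat.primeFactors_mono hP hPz0
  have h01 : ∀ p ∈ Pz.primeFactors, 0 ≤ g p ∧ g p ≤ 1 := fun p hp =>
    ⟨(hdim.1 p (Nat.prime_of_mem_primeFactors hp)).1,
      (hdim.1 p (Nat.prime_of_mem_primeFactors hp)).2.le⟩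
  have h01P : ∀ p ∈ P.primeFactors, 0 ≤ g p ∧ g p ≤ 1 := fun p hp => h01 p (hsub hp)
  -- positivity of `V(P(z))`
  have hVz : 0 < vprod g Pz :=
    Finset.prod_pos fun p hp => sub_pos.mpr (hdim.1 p (Nat.prime_of_mem_primeFactors hp)).2
  have hVP : 0 ≤ vprod g P := vprod_nonneg h01P
  -- `g ≥ 0` on the divisors of `P(z)`
  have hg0 : ∀ t ∈ Pz.divisors, 0 ≤ g t := by
    intro t ht
    have htd : t ∣ Pz := Nat.dvd_of_mem_divisors ht
    rw [map_eq_prod_primeFactors hg (hPzsq.squarefree_of_dvd htd)]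
    exact Finset.prod_nonneg fun p hp => (h01 p (Nat.primeFactors_mono htd hPz0 hp)).1
  have hdivsub : P.divisors ⊆ Pz.divisors := Nat.divisors_subset_of_dvd hPz0 hP
  -- the tree's bound for `P(z)`
  have hz' := bdry_sum_le (par := par) hg hdim hκ hz hD1 hβ hzD
  -- termwise comparison after multiplying by `V(P(z))`
  have hterm : ∀ t ∈ P.divisors,
      (bdry par β D t * g t * vlt g P t.minFac) * vprod g Pz ≤
        vprod g P * (bdry par β D t * g t * vlt g Pz t.minFac) := by
    intro t ht
    have hbg : 0 ≤ bdry par β D t * g t := mul_nonneg (bdry_nonneg t) (hg0 t (hdivsub ht))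
    calc (bdry par β D t * g t * vlt g P t.minFac) * vprod g Pz
        = (bdry par β D t * g t) * (vlt g P t.minFac * vprod g Pz) := by ring
      _ ≤ (bdry par β D t * g t) * (vprod g P * vlt g Pz t.minFac) :=
          mul_le_mul_of_nonneg_left (vlt_mul_vprod_le hsub h01 _) hbg
      _ = vprod g P * (bdry par β D t * g t * vlt g Pz t.minFac) := by ring
  have hsum : (∑ t ∈ P.divisors, bdry par β D t * g t * vlt g P t.minFac) * vprod g Pz ≤
      vprod g P * ∑ t ∈ Pz.divisors, bdry par β D t * g t * vlt g Pz t.minFac := by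
    rw [Finset.sum_mul, Finset.mul_sum]
    calc ∑ t ∈ P.divisors, bdry par β D t * g t * vlt g P t.minFac * vprod g Pz
        ≤ ∑ t ∈ P.divisors, vprod g P * (bdry par β D t * g t * vlt g Pz t.minFac) :=
          Finset.sum_le_sum hterm
      _ ≤ ∑ t ∈ Pz.divisors, vprod g P * (bdry par β D t * g t * vlt g Pz t.minFac) :=
          Finset.sum_le_sum_of_subset_of_nonneg hdivsub fun t ht _ =>
            mul_nonneg hVP (mul_nonneg (mul_nonneg (bdry_nonneg t) (hg0 t ht)) (vlt_nonneg h01 _))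
  have hfin : (∑ t ∈ P.divisors, bdry par β D t * g t * vlt g P t.minFac) * vprod g Pz ≤
      (2 * K ^ (10 : ℕ) * Real.exp (β - Real.log D / Real.log z) * vprod g P) * vprod g Pz :=
    calc _ ≤ vprod g P * ∑ t ∈ Pz.divisors, bdry par β D t * g t * vlt g Pz t.minFac := hsum
      _ ≤ vprod g P * (2 * K ^ (10 : ℕ) * Real.exp (β - Real.log D / Real.log z) * vprod g Pz) :=
          mul_le_mul_of_nonneg_left hz' hVP
      _ = _ := by ring
  exact le_of_mul_le_mul_right hfin hVz

end BetaSieve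

namespace SieveSequence

open BetaSieve

variable {A : SieveSequence} {κ K : ℝ}

/-- The prime factors of a divisor of `P ∣ P(z)` are `< z`. [folklore] -/
theorem prime_lt_of_dvd_of_dvd {z : ℝ} {P t p : ℕ} (hP : P ∣ primesProdBelow z) (ht : t ∣ P)
    (hp : p ∈ t.primeFactors) : (p : ℝ) < z :=
  prime_lt_of_mem_primeFactors_of_dvd (ht.trans hP) hp

/-- **Greaves, Theorem 3.3.1 (`b = 9`), upper truncation set, for a sifting set `P ∣ P(z)`**:
the weighted sum `∑_{d ∣ P} μ(d)χ(d) A_d(x)` is `X V(P)` up to `2K^{10}e^{β−s} X V(P)` and the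
remainder sum, `s = log D / log z`, `β = 9κ + 1`, for either parity `par`. The tree's
`abs_weightedSum_sub_le` is the case `P = P(z)`; the proof is the same, with
`BetaSieve.bdry_sum_le_of_dvd` in place of `bdry_sum_le`.
[cite: Greaves2001, §3.3.4 Thm 1] [cite: FriedlanderIwaniecOpera2010, Lemma 6.8] -/
theorem abs_weightedSum_sub_le_of_dvd (hdim : HasSieveDimension A.density κ K) (hκ : 0 < κ)
    (par : ℕ) {β x z D : ℝ} (hz : 2 ≤ z) (hD1 : 1 < D) (hβ : β = 9 * κ + 1)
    (hzD : β * Real.log z ≤ Real.log D) (hX : 0 ≤ A.size x) {P : ℕ}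
    (hP : P ∣ primesProdBelow z) :
    |∑ d ∈ P.divisors, ((μ d : ℝ) * ind par β D d) * A.congrSum d x -
        A.size x * A.densityProduct P| ≤
      2 * K ^ (10 : ℕ) * Real.exp (β - Real.log D / Real.log z) * A.size x *
          A.densityProduct P +
        ∑ d ∈ P.divisors.filter (fun d : ℕ => (d : ℝ) ≤ D), |A.remainder d x| := by
  have hPsq : Squarefree P := (squarefree_primesProdBelow z).squarefree_of_dvd hP
  have hP0 : P ≠ 0 := hPsq.ne_zero
  have hβ1 : 1 < β := by rw [hβ]; linarith
  have hg := A.density_mult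
  have h01 : ∀ p ∈ P.primeFactors, 0 ≤ A.density p ∧ A.density p ≤ 1 := fun p hp =>
    ⟨(hdim.1 p (Nat.prime_of_mem_primeFactors hp)).1,
      (hdim.1 p (Nat.prime_of_mem_primeFactors hp)).2.le⟩
  have hVdef : A.densityProduct P = vprod A.density P := rfl
  -- split `A_d = g(d) X + R_d`
  have hsplit : ∑ d ∈ P.divisors, ((μ d : ℝ) * ind par β D d) * A.congrSum d x =
      A.size x * ∑ d ∈ P.divisors, (μ d : ℝ) * ind par β D d * A.density d +
        ∑ d ∈ P.divisors, ((μ d : ℝ) * ind par β D d) * A.remainder d x := by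
    rw [Finset.mul_sum, ← Finset.sum_add_distrib]
    refine Finset.sum_congr rfl fun d _ => ?_
    rw [remainder]
    ring
  -- main term
  have hg0 : ∀ t ∈ P.divisors, 0 ≤ A.density t := by
    intro t ht
    have htd : t ∣ P := Nat.dvd_of_mem_divisors ht
    rw [map_eq_prod_primeFactors hg (hPsq.squarefree_of_dvd htd)]
    exact Finset.prod_nonneg fun p hp => (h01 p (Nat.primeFactors_mono htd hP0 hp)).1
  have hmain : |∑ d ∈ P.divisors, (μ d : ℝ) * ind par β D d * A.density d - vprod A.density P| ≤
      2 * K ^ (10 : ℕ) * Real.exp (β - Real.log D / Real.log z) * vprod A.density P :=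
    (abs_mainTerm_sub_le hg hPsq hg0 (vlt_nonneg h01)).trans
      (bdry_sum_le_of_dvd hg hdim hκ hz hD1 hβ hzD hP)
  -- remainder term
  have hrem : |∑ d ∈ P.divisors, ((μ d : ℝ) * ind par β D d) * A.remainder d x| ≤
      ∑ d ∈ P.divisors.filter (fun d : ℕ => (d : ℝ) ≤ D), |A.remainder d x| := by
    rw [Finset.sum_filter]
    refine (Finset.abs_sum_le_sum_abs _ _).trans (Finset.sum_le_sum fun d hd => ?_)
    by_cases hpred : pred par β D d
    · have hdd : d ∣ P := Nat.dvd_of_mem_divisors hd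
      have hlt : (d : ℝ) < D := lt_level_of_pred hβ1 hD1 hzD (hPsq.squarefree_of_dvd hdd)
        (fun p hp => prime_lt_of_dvd_of_dvd hP hdd hp) hpred
      rw [if_pos hlt.le, abs_mul, abs_mul]
      have hμ : |(μ d : ℝ)| ≤ 1 := by exact_mod_cast ArithmeticFunction.abs_moebius_le_one
      calc |(μ d : ℝ)| * |ind par β D d| * |A.remainder d x| ≤ 1 * 1 * |A.remainder d x| := by
            gcongr
            · exact abs_ind_le_one d
        _ = |A.remainder d x| := by ring
    · rw [ind_of_not_pred hpred, mul_zero, zero_mul, abs_zero]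
      split_ifs
      · exact abs_nonneg _
      · exact le_rfl
  -- combine
  rw [hsplit, hVdef]
  have hXmain : |A.size x * ∑ d ∈ P.divisors, (μ d : ℝ) * ind par β D d * A.density d -
      A.size x * vprod A.density P| ≤
      2 * K ^ (10 : ℕ) * Real.exp (β - Real.log D / Real.log z) * A.size x * vprod A.density P := by
    rw [← mul_sub, abs_mul, abs_of_nonneg hX]
    calc A.size x * |∑ d ∈ P.divisors, (μ d : ℝ) * ind par β D d * A.density d - vprod A.density P|
        ≤ A.size x *
            (2 * K ^ (10 : ℕ) * Real.exp (β - Real.log D / Real.log z) * vprod A.density P) :=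
          mul_le_mul_of_nonneg_left hmain hX
      _ = _ := by ring
  calc |A.size x * ∑ d ∈ P.divisors, (μ d : ℝ) * ind par β D d * A.density d +
          ∑ d ∈ P.divisors, ((μ d : ℝ) * ind par β D d) * A.remainder d x -
          A.size x * vprod A.density P|
      = |(A.size x * ∑ d ∈ P.divisors, (μ d : ℝ) * ind par β D d * A.density d -
          A.size x * vprod A.density P) +
          ∑ d ∈ P.divisors, ((μ d : ℝ) * ind par β D d) * A.remainder d x| := by ring_nf
    _ ≤ _ := (abs_add_le _ _).trans (add_le_add hXmain hrem)

/-- **The beta-sieve upper bound for a sifting set `P ∣ P(z)`** (Greaves, *Sieves in Number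
Theory*, Thm 3.3.1 and Cor 3.3.1.1 with `b = 9`; Friedlander–Iwaniec, *Opera de Cribro*,
Lemma 6.8 / Thm 6.9, where the sifting range is `P(z) = ∏_{p ∈ 𝒫, p < z} p` for an arbitrary set
of primes `𝒫`): for a sifted sequence of dimension `κ > 0` (constant `K`), `z ≥ 2`, `D > 1`
with `D ≥ z^{9κ+1}`, and `X(x) ≥ 0`,
`S(𝒜, P; x) ≤ (1 + 2 K^{10} e^{9κ+1−s}) X V(P) + ∑_{d ∣ P, d ≤ D} |R_d(x)|`, `s = log D / log z`,
`V(P) = ∏_{p ∣ P} (1 − g(p))`. (Only the upper inequality is recorded; it is the one needed to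
sift subsequences `𝒜_d` by the primes `< z` coprime to `d`.)
[cite: Greaves2001, §3.3.4 Thm 1 and Cor 1.1] [cite: FriedlanderIwaniecOpera2010, Lemma 6.8 and Thm. 6.9] -/
theorem sifted_le_of_dvd_primesProdBelow (hdim : HasSieveDimension A.density κ K) (hκ : 0 < κ)
    {x z D : ℝ} (hz : 2 ≤ z) (hD1 : 1 < D) (hzD : (9 * κ + 1) * Real.log z ≤ Real.log D)
    (hX : 0 ≤ A.size x) {P : ℕ} (hP : P ∣ primesProdBelow z) :
    A.sifted x P ≤
      (1 + 2 * K ^ (10 : ℕ) * Real.exp ((9 * κ + 1) - Real.log D / Real.log z)) *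
          (A.size x * A.densityProduct P) +
        ∑ d ∈ P.divisors.filter (fun d : ℕ => (d : ℝ) ≤ D), |A.remainder d x| := by
  have hPsq : Squarefree P := (squarefree_primesProdBelow z).squarefree_of_dvd hP
  have hup := abs_weightedSum_sub_le_of_dvd hdim hκ 1 hz hD1 rfl hzD hX hP
  have h1 := A.sifted_le_upperSum (β := 9 * κ + 1) (D := D) x hPsq
  rw [abs_le] at hup
  calc A.sifted x P ≤ _ := h1
    _ ≤ _ := by linarith [hup.2]

end SieveSequence

end Literature.NumberTheory.Sieve
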